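import Literature.AlgebraicGeometry.Modules.PullbackPushforwardTraceChart
import HarnessLib

/-!
# The trace retraction `ρ_M : f_*f^*M ⟶ M` and `η_M ≫ ρ_M = deg f · 𝟙_M` (The Stacks Project, Tag 0BVH, for modules)

Let `f : X → Y` be an AFFINE morphism of schemes whose direct image `f_*𝒪_X` is finite locally free (`h`; e.g. `f` finite locally
free — an isogeny of abelian varieties), and `M` an affine-localizing (e.g. quasi-coherent) `𝒪_Y`-module. The chart maps
`ρ_V : Γ(f⁻¹V, f^*M) → Γ(V, M)`, `c · η(m)| ↦ Tr_V(c) · m` of `Modules/PullbackPushforwardTraceChart` (`traceRetractionApp`), defined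
on the AFFINE opens `V ⊆ Y` and compatible with restriction between them, glue (Mathlib `TopCat.Sheaf.restrictHomEquivHom` on the basis
of affine opens; The Stacks Project, Tag 009U) to a morphism of `𝒪_Y`-modules

  `ρ_M = traceRetraction f h M hM : f_*f^*M ⟶ M`

— the projection-formula map `1 ⊗ Tr_f : M ⊗ f_*𝒪_X → M ⊗ 𝒪_Y = M` (Hartshorne II Ex. 5.1 (d)), constructed WITHOUT the projection
formula for Mathlib's abstract `Scheme.Modules.pullback`. Main results:

* `traceRetraction_app_of_isAffineOpen` — on an affine chart `ρ_M` is `ρ_V`;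
* **`pullbackUnit_comp_traceRetraction`** — if `f_*𝒪_X` is framed of one cardinality `n` near every point (`f` of constant degree
  `n`), then `η_M ≫ ρ_M = n • 𝟙_M` («the composition `𝒪_Y → π_*𝒪_X → 𝒪_Y` equals multiplication by the degree», Tag 0BVH, tensored
  with `M`): the unit `M → f_*f^*M` is a SPLIT MONOMORPHISM up to the degree;
* **`traceRetraction_naturality`** — `ρ` is natural in `M` (`f_*f^*φ ≫ ρ_N = ρ_M ≫ φ`).

Everything is proved; no named facts, no `sorry`. Written for Hodge road №4 (crux stmt-HodgeConjecture-26512, lens line N′, parked input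
(R) of `Summits/…/Theorems/VHCAbelianSchemesRoadExtJumpLocusLiftsOfRetract`: bounded vector-bundle complexes are retracts of `q_*q^*`
along an isogeny `q`, via `Literature/Algebra/Homology/RetractOfNaturalRetraction`).

## References

* The Stacks Project, Tag 0BVH (the trace of a finite locally free morphism; `Trace_π ∘ π♯ = deg π`), Tag 009U (morphisms of sheaves on
  a basis). [StacksProject]
* R. Hartshorne, *Algebraic Geometry*, GTM 52 (1977), II Ex. 5.1 (d) (projection formula), IV Ex. 2.6 (trace of a finite flat
  morphism). [Hartshorne1977]
* U. Görtz, T. Wedhorn, *Algebraic Geometry I: Schemes*, 2nd ed. (2020), Prop. 7.24 (2). [GortzWedhorn2020]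
-/

noncomputable section

-- `TopCat.Presheaf`/`Scheme.Modules` are not reducible (as in Mathlib's `AlgebraicGeometry/Modules/Sheaf.lean`).
set_option backward.isDefEq.respectTransparency false

open CategoryTheory AlgebraicGeometry TopologicalSpace Opposite
open AlgebraicGeometry.Scheme.Modules

universe u

namespace Literature.AlgebraicGeometry.Modules

open Literature.AlgebraicGeometry.Motives

variable {X Y : Scheme.{u}} (f : X ⟶ Y)
  (h : IsFiniteLocallyFree ((pushforward f).obj (unitModule X)))
  (M : Y.Modules)

/-! ## §2 Gluing: the sheaf morphism `ρ_M : f_*f^*M ⟶ M` from the affine charts -/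

section Glue

-- the identification `Γ(f_*N, V) = Γ(N, f⁻¹V)` (Mathlib `pushforward_obj_obj`, `rfl`) is unfolded at depth by the unifier below
set_option maxRecDepth 20000

variable [IsAffineHom f] (hM : IsAffineLocalizing M)

/-- The underlying abelian sheaf of an `𝒪`-module (Mathlib `SheafOfModules.toSheaf`, spelled on `Scheme.Modules.presheaf`). [folklore] -/
abbrev modAbSheaf {Z : Scheme.{u}} (N : Z.Modules) : TopCat.Sheaf Ab Z := ⟨N.presheaf, N.isSheaf⟩

/-- The affine opens of `Y`, as a family indexed by themselves, form a basis. [cite: StacksProject, Tag 009U] -/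
theorem isBasis_range_affineOpens (Z : Scheme.{u}) :
    Opens.IsBasis (Set.range (fun U : Z.affineOpens => (U : Z.Opens))) := by
  rw [Subtype.range_coe_subtype]
  exact Z.isBasis_affineOpens

/-- `ρ` commutes with restriction between affine charts, as an identity of morphisms of abelian groups. [cite: StacksProject, Tag 0BVH] -/
theorem map_comp_traceRetractionApp {V V' : Y.Opens} (hV : IsAffineOpen V) (hV' : IsAffineOpen V') (k : V' ⟶ V) :
    ((pushforward f).obj ((pullback f).obj M)).presheaf.map k.op ≫ AddCommGrpCat.ofHom (traceRetractionApp f h M hV' hM) =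
      AddCommGrpCat.ofHom (traceRetractionApp f h M hV hM) ≫ M.presheaf.map k.op := by
  ext s
  simp only [ConcreteCategory.comp_apply, AddCommGrpCat.hom_ofHom, Scheme.Modules.pushforward_obj_presheaf_map]
  exact traceRetractionApp_map f h M hV hM hV' k s

/-- The chart data `ρ_V`, `V` affine, as a natural transformation between the restrictions of (the abelian presheaves of)
`f_*f^*M` and `M` to the affine opens (naturality = `traceRetractionApp_map`). [cite: StacksProject, Tag 0BVH] -/
def traceRetractionRestricted :
    (inducedFunctor (fun U : Y.affineOpens => (U : Y.Opens))).op ⋙ ((pushforward f).obj ((pullback f).obj M)).presheaf ⟶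
      (inducedFunctor (fun U : Y.affineOpens => (U : Y.Opens))).op ⋙ M.presheaf where
  app U := AddCommGrpCat.ofHom (traceRetractionApp f h M U.unop.2 hM)
  naturality U U' k := map_comp_traceRetractionApp f h M hM U.unop.2 U'.unop.2 k.unop.hom

/-- **The trace retraction on abelian presheaves**, `f_*f^*M ⟶ M`, extended from the affine charts (Mathlib
`TopCat.Sheaf.restrictHomEquivHom`). [cite: StacksProject, Tag 0BVH] [cite: StacksProject, Tag 009U] -/
def traceRetractionPresheaf : ((pushforward f).obj ((pullback f).obj M)).presheaf ⟶ M.presheaf :=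
  TopCat.Sheaf.restrictHomEquivHom ((pushforward f).obj ((pullback f).obj M)).presheaf (modAbSheaf M)
    (isBasis_range_affineOpens Y) (traceRetractionRestricted f h M hM)

/-- On an affine open the extension IS the chart map `ρ_V`. [cite: StacksProject, Tag 009U] -/
theorem traceRetractionPresheaf_app_apply {V : Y.Opens} (hV : IsAffineOpen V)
    (s : Γ((pullback f).obj M, f ⁻¹ᵁ V)) :
    (traceRetractionPresheaf f h M hM).app (op V) s = traceRetractionApp f h M hV hM s :=
  ConcreteCategory.congr_hom (TopCat.Sheaf.extend_hom_app ((pushforward f).obj ((pullback f).obj M)).presheaf (modAbSheaf M)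
    (isBasis_range_affineOpens Y) (traceRetractionRestricted f h M hM) ⟨V, hV⟩) s

/-- Naturality of the extension along an inclusion, on elements. [cite: StacksProject, Tag 009U] -/
theorem map_traceRetractionPresheaf_app {W W' : Y.Opens} (k : W' ⟶ W)
    (t : Γ((pushforward f).obj ((pullback f).obj M), W)) :
    M.presheaf.map k.op ((traceRetractionPresheaf f h M hM).app (op W) t) =
      (traceRetractionPresheaf f h M hM).app (op W')
        (((pushforward f).obj ((pullback f).obj M)).presheaf.map k.op t) := by
  have h' := ConcreteCategory.congr_hom ((traceRetractionPresheaf f h M hM).naturality k.op) t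
  rw [ConcreteCategory.comp_apply, ConcreteCategory.comp_apply] at h'
  exact h'.symm

/-- **The extension is `𝒪_Y`-linear on every open** (it is on affine opens by `traceRetractionApp_smul`, and sections of the sheaf `M`
are determined by their restrictions to the affine opens). [cite: StacksProject, Tag 0BVH] -/
theorem traceRetractionPresheaf_app_smul (W : Y.Opens) (r : Γ(Y, W))
    (s : Γ((pushforward f).obj ((pullback f).obj M), W)) :
    (traceRetractionPresheaf f h M hM).app (op W) (r • s) = r • (traceRetractionPresheaf f h M hM).app (op W) s := by
  -- cover `W` by the affine opens inside it
  let J := {V : Y.affineOpens // (V : Y.Opens) ≤ W}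
  let C : J → Y.Opens := fun j => j.1
  have hcov : W ≤ iSup C := fun y hy => by
    obtain ⟨_, ⟨V, hV, rfl⟩, hyV, hVW⟩ := Y.isBasis_affineOpens.exists_subset_of_mem_open hy W.2
    exact Opens.mem_iSup.mpr ⟨⟨⟨V, hV⟩, hVW⟩, hyV⟩
  refine TopCat.Sheaf.eq_of_locally_eq' (modAbSheaf M) C W (fun j => homOfLE j.2) hcov
    ((traceRetractionPresheaf f h M hM).app (op W) (r • s)) (r • (traceRetractionPresheaf f h M hM).app (op W) s) fun j => ?_
  change M.presheaf.map (homOfLE j.2).op ((traceRetractionPresheaf f h M hM).app (op W) (r • s)) =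
    M.presheaf.map (homOfLE j.2).op (r • (traceRetractionPresheaf f h M hM).app (op W) s)
  have e1 := map_traceRetractionPresheaf_app f h M hM (homOfLE j.2) (r • s)
  have e2 := map_traceRetractionPresheaf_app f h M hM (homOfLE j.2) s
  have e3 : ((pushforward f).obj ((pullback f).obj M)).presheaf.map (homOfLE j.2).op (r • s) =
      Y.presheaf.map (homOfLE j.2).op r • ((pushforward f).obj ((pullback f).obj M)).presheaf.map (homOfLE j.2).op s :=
    Scheme.Modules.map_smul _ _ r s
  have e4 : M.presheaf.map (homOfLE j.2).op (r • (traceRetractionPresheaf f h M hM).app (op W) s) =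
      Y.presheaf.map (homOfLE j.2).op r • M.presheaf.map (homOfLE j.2).op ((traceRetractionPresheaf f h M hM).app (op W) s) :=
    Scheme.Modules.map_smul _ _ r _
  rw [e1, e3, e4, e2, traceRetractionPresheaf_app_apply f h M hM j.1.2, traceRetractionPresheaf_app_apply f h M hM j.1.2]
  exact traceRetractionApp_smul f h M j.1.2 hM _ _

/-- **THE TRACE RETRACTION `ρ_M : f_*f^*M ⟶ M`** of an affine-localizing `𝒪_Y`-module along an affine morphism with `f_*𝒪_X`
finite locally free: the morphism of `𝒪_Y`-modules which on an affine chart `V` is `c · η(m)| ↦ Tr_V(c) · m` (the projection-formula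
map `1 ⊗ Tr_f : M ⊗ f_*𝒪_X → M`, built chart by chart). [cite: StacksProject, Tag 0BVH] -/
def traceRetraction : (pushforward f).obj ((pullback f).obj M) ⟶ M :=
  ⟨PresheafOfModules.homMk (traceRetractionPresheaf f h M hM) fun W r s => traceRetractionPresheaf_app_smul f h M hM W.unop r s⟩

/-- On an affine chart `ρ_M` is `ρ_V`. [cite: StacksProject, Tag 0BVH] -/
theorem traceRetraction_app_of_isAffineOpen {V : Y.Opens} (hV : IsAffineOpen V) (s : Γ((pullback f).obj M, f ⁻¹ᵁ V)) :
    (traceRetraction f h M hM).app V s = traceRetractionApp f h M hV hM s :=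
  traceRetractionPresheaf_app_apply f h M hM hV s

/-- Sections of an `ℕ`-multiple of a morphism of `𝒪`-modules: `(n • φ)_U(x) = n • φ_U(x)`. [folklore] -/
private theorem nsmul_app_apply' {A B : Y.Modules} (φ : A ⟶ B) (n : ℕ) (U : Y.Opens) (x : Γ(A, U)) :
    (n • φ).app U x = n • φ.app U x := by
  induction n with
  | zero =>
    rw [zero_nsmul, zero_nsmul, Scheme.Modules.Hom.zero_app]
    rfl
  | succ n ih =>
    rw [succ_nsmul, succ_nsmul, Scheme.Modules.Hom.add_app, ← ih]
    rfl

/-- **`η ≫ ρ = deg · 𝟙`: the trace retraction retracts the unit up to the degree.** If `f_*𝒪_X` is framed of one cardinality `n`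
near every point of `Y` (`f` of constant degree `n`), then `η_M ≫ ρ_M = n • 𝟙_M` for every affine-localizing `M` (checked on the
affine charts inside the framed opens, which cover `Y`: there `ρ_V(η(m)) = n · m`, `traceRetractionApp_unitSection_of_frame`).
[cite: StacksProject, Tag 0BVH] -/
theorem pullbackUnit_comp_traceRetraction (n : ℕ)
    (hn : ∀ y : Y, ∃ (V : Y.Opens) (_ : y ∈ V) (I : Type u) (_ : Fintype I)
      (_ : SheafOfModules.free I ≅ ((pushforward f).obj (unitModule X)).over V), Fintype.card I = n) :
    pullbackUnit f M ≫ traceRetraction f h M hM = n • 𝟙 M := by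
  apply Scheme.Modules.hom_ext
  intro W
  ext s
  change (pullbackUnit f M ≫ traceRetraction f h M hM).app W s = (n • 𝟙 M : M ⟶ M).app W s
  -- the affine opens inside `W` carrying a frame of `f_*𝒪_X` of cardinality `n` cover `W`
  let J := Σ' (V : Y.affineOpens) (_ : (V : Y.Opens) ≤ W) (I : Type u) (_ : Fintype I)
    (_ : SheafOfModules.free I ≅ ((pushforward f).obj (unitModule X)).over (V : Y.Opens)), Fintype.card I = n
  let C : J → Y.Opens := fun j => j.1
  have hcov : W ≤ iSup C := fun y hy => by
    obtain ⟨V₀, hyV₀, I, hI, e, hcard⟩ := hn y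
    obtain ⟨_, ⟨V, hV, rfl⟩, hyV, hVle⟩ := Y.isBasis_affineOpens.exists_subset_of_mem_open
      (show y ∈ W ⊓ V₀ from ⟨hy, hyV₀⟩) (W ⊓ V₀).2
    have hVW : V ≤ W := fun z hz => (hVle hz).1
    have hVV₀ : V ≤ V₀ := fun z hz => (hVle hz).2
    exact Opens.mem_iSup.mpr ⟨⟨⟨V, hV⟩, hVW, I, hI,
      Literature.AlgebraicGeometry.Motives.SheafOfModules.restrictTrivialisation (R := Y.ringCatSheaf) (homOfLE hVV₀) e, hcard⟩, hyV⟩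
  refine TopCat.Sheaf.eq_of_locally_eq' (modAbSheaf M) C W (fun j => homOfLE j.2.1) hcov
    ((pullbackUnit f M ≫ traceRetraction f h M hM).app W s) ((n • 𝟙 M : M ⟶ M).app W s) fun j => ?_
  obtain ⟨V, hVW, I, hI, e, hcard⟩ := j
  change M.presheaf.map (homOfLE hVW).op ((pullbackUnit f M ≫ traceRetraction f h M hM).app W s) =
    M.presheaf.map (homOfLE hVW).op ((n • 𝟙 M : M ⟶ M).app W s)
  rw [← Scheme.Modules.Hom.app_map_apply, ← Scheme.Modules.Hom.app_map_apply, Scheme.Modules.Hom.comp_app,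
    ConcreteCategory.comp_apply, nsmul_app_apply', Scheme.Modules.Hom.id_app]
  change (traceRetraction f h M hM).app (V : Y.Opens) (unitSection f M (V : Y.Opens) (M.presheaf.map (homOfLE hVW).op s)) =
    n • M.presheaf.map (homOfLE hVW).op s
  rw [traceRetraction_app_of_isAffineOpen f h M hM V.2, traceRetractionApp_unitSection_of_frame f h M V.2 hM e, hcard,
    Nat.cast_smul_eq_nsmul]


/-- **`ρ` is natural in `M`**: for `φ : M → N` between affine-localizing modules, `f_*f^*φ ≫ ρ_N = ρ_M ≫ φ` (two morphisms into the sheaf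
`N` agreeing on the affine opens, `traceRetractionApp_naturality`). [cite: StacksProject, Tag 0BVH] -/
theorem traceRetraction_naturality {N : Y.Modules} (hN : IsAffineLocalizing N) (φ : M ⟶ N) :
    (pushforward f).map ((pullback f).map φ) ≫ traceRetraction f h N hN = traceRetraction f h M hM ≫ φ := by
  apply (Scheme.Modules.toPresheaf Y).map_injective
  refine TopCat.Sheaf.hom_ext _ (modAbSheaf N) (isBasis_range_affineOpens Y) fun U => ?_
  ext s
  change ((pushforward f).map ((pullback f).map φ) ≫ traceRetraction f h N hN).app (U : Y.Opens) s =
    (traceRetraction f h M hM ≫ φ).app (U : Y.Opens) s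
  rw [Scheme.Modules.Hom.comp_app, Scheme.Modules.Hom.comp_app, ConcreteCategory.comp_apply, ConcreteCategory.comp_apply,
    pushforward_map_app, traceRetraction_app_of_isAffineOpen f h M hM U.2]
  exact (traceRetraction_app_of_isAffineOpen f h N hN U.2 _).trans (traceRetractionApp_naturality f h M U.2 hM hN φ s)

end Glue

end Literature.AlgebraicGeometry.Modules
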